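import Literature.Probability.RandomPlanarGeometry.SLETargetIndependenceSix
import Literature.Probability.RandomPlanarGeometry.CritPercSLESimplePathHolds
import Literature.Probability.RandomPlanarGeometry.SimpleCurves
import Summits.CriticalPhenomena.CardyFormulaZ2.Theorems.CardyRotToConfR2SymmetryUpgrade.Negative.TargetIndependence
import HarnessLib

/-!
# Stub `stub_localityPinsSix` (S3B, "locality pins κ = 6") of line `isotropy-kills-beltrami`,
# crux `CardyRotToConfR2SymmetryUpgrade` (stmt-CriticalPhenomena-0698)

A chordal family all of whose laws are chordal SLE_κ laws (`κ > 0`), local in restriction form and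
target independent (splitting form), has `κ = 6` (Lawler–Schramm–Werner (2001), §3; Werner (2007),
Prop. 3.4: among the SLE_κ only SLE₆ is local). Only target independence is used:

* `0 < κ ≤ 4`: the laws are carried by simple curves meeting `∂D` only at the two marked points
  (Rohde–Schramm (2005), Thm. 6.1, `IsSLELaw.ae_simple`), which is incompatible with target
  independence (`Negative.not_forall_ae_boundaryAvoiding`):
  `not_isTargetIndependent_of_isSLELaw_of_le_four` (wave-1 worker S3);
* `κ > 4`: `eq_six_of_isSLELaw_of_isTargetIndependent_of_four_lt`
  (`Literature/Probability/RandomPlanarGeometry/SLETargetIndependenceSix.lean`): in the three-marked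
  unit disc `(𝔻; 1, i, -1)`, target independence equates Lawler's two-sided swallowing law with
  Rohde–Schramm's same-side law at every cross-ratio, which forces `κ = 6` for `4 < κ < 8` and is
  impossible for `κ ≥ 8` (space-filling trace).
-/

noncomputable section

namespace Summit.CriticalPhenomena.CardyFormulaZ2.Theorems.CardyRotToConfR2SymmetryUpgrade.IsotropyKillsBeltrami

open MeasureTheory Set Filter Topology
open Literature.Probability.RandomPlanarGeometry
open scoped ENNReal NNReal unitInterval

/-- **A family of chordal SLE_κ laws is chordal** (`κ` arbitrary): every law is a probability
measure carried by curves from `a` to `b` in `closure D`. Lawler (2005), §6.3. -/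
theorem isChordal_of_isSLELaw {κ : ℝ≥0} {Q : ChordalFamily}
    (hQ : ∀ D : DobrushinDomain, IsSLELaw κ D (Q D)) : Q.IsChordal := by
  haveI : Fact Literature.Probability.Process.isProjectiveLimit_preWienerMeasure :=
    ⟨isProjectiveLimit_preWienerMeasure_holds⟩
  exact fun D => ⟨(hQ D).isProbabilityMeasure,
    (hQ D).ae_endpoints JordanDomain.mapsTo_boundaryExtension_holds⟩

/-- **For `0 < κ ≤ 4` a family of chordal SLE_κ laws is not target independent**: its laws are
carried by simple curves meeting `∂D` only at `a, b` (Rohde–Schramm (2005), Thm. 6.1,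
`IsSLELaw.ae_simple`), contradicting `Negative.not_forall_ae_boundaryAvoiding`. -/
theorem not_isTargetIndependent_of_isSLELaw_of_le_four {κ : ℝ≥0} (hκ0 : 0 < κ) (hκ4 : κ ≤ 4)
    {Q : ChordalFamily} (hQ : ∀ D : DobrushinDomain, IsSLELaw κ D (Q D)) :
    ¬ Q.IsTargetIndependent := fun hT =>
  Negative.not_forall_ae_boundaryAvoiding (isChordal_of_isSLELaw hQ) hT fun E => by
    filter_upwards [(hQ E).ae_simple ae_isSimpleTrace_sleTrace_of_le_four_holds
      CurveClass.measurableSet_simple_holds hκ0 hκ4] with γ hγ using hγ.2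

/-- Registered stub `stub_localityPinsSix` (S3B · LOCALITY PINS κ = 6). A chordal family all of
whose laws are chordal SLE_κ laws (`κ > 0`) and which is local in restriction form and target
independent (splitting form) has `κ = 6` (Lawler–Schramm–Werner (2001), §3; Werner (2007),
Prop. 3.4). Only target independence is used: `κ ≤ 4` is excluded by
`not_isTargetIndependent_of_isSLELaw_of_le_four` (simple curves are never target independent), and
for `κ > 4` `eq_six_of_isSLELaw_of_isTargetIndependent_of_four_lt` applies in the three-marked unit
disc `(𝔻; 1, i, -1)` (two-sided vs same-side swallowing laws at every cross-ratio). -/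
theorem stub_localityPinsSix :
    ∀ (κ : ℝ≥0) (Q : ChordalFamily), 0 < κ → (∀ D : DobrushinDomain, IsSLELaw κ D (Q D)) →
      Q.IsLocal → Q.IsTargetIndependent → κ = 6 := by
  intro κ Q hκ0 hQ _ hT
  rcases le_or_gt κ 4 with h4 | h4
  · exact absurd hT (not_isTargetIndependent_of_isSLELaw_of_le_four hκ0 h4 hQ)
  · exact eq_six_of_isSLELaw_of_isTargetIndependent_of_four_lt h4 hQ hT
      (ConformalRectangle.unitDisc.restrictMarks Fin.castSuccOrderEmb)

end Summit.CriticalPhenomena.CardyFormulaZ2.Theorems.CardyRotToConfR2SymmetryUpgrade.IsotropyKillsBeltrami
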